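import Summits.PneNP.PneNP.Theorems.ChebyshevTracialDesignTightColumnSums
import HarnessLib

/-!
# Cell pnp-psdrank, route `ChebyshevTracialDesign`: the saturated subsets of a cut — the binomial-moment kernels
# `E^{(a)}(U,M) = C(e(U,M), a)` of the saturation factorisation

Harmonic backbone, brick 3' (MEMO-7 §1 (1a), general level). For a perfect matching encoded by its fixed-point-free
partner involution `π` and a vertex set `U`, the `π`-CLOSED (`M`-saturated) subsets of `U` of size `2a` are counted by
the `a`-subsets of the INNER KEYS of `U` (keys `x < π x` with both `x, π x ∈ U`): `card_closed_subsets_eq_choose`,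
`#{V ⊆ U : |V| = 2a, πV = V} = C(e, a)` with `2e = #{x ∈ U : π x ∈ U}` (`two_mul_card_innerKeys`), i.e.
`e = e(U,M)` = the number of edges of `M` inside `U`, and `|U| = cc(U,M) + 2e(U,M)` (`card_eq_cc_add`, with
`cc U M = #{x ∈ U : partner x ∉ U}` from `…TightColumnSums`). Consequently the kernels
`E^{(a)}(U,M) := #{V ⊆ U : |V| = 2a, M|_V perfect}` are the binomial moments `C(e(U,M), a)` of the level statistic and
`E^{(a)} = Σ_{e' ≥ a} C(e',a)·A_{t−2e'}` is unitriangular in Rothvoß's level kernels `A_c = 1[cc = c]`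
[cite: Rothvoss2017, §2 (PDF p. 6)]; the tight level is `a = (t−1)/2` (`…TightLayerSums`). Since `E^{(a)} = 𝒰 ∘ B_{2a}`
(sum over closed `2a`-sets `V ⊆ U`), the slice ladders (p437052) and the `B`-scalar (p438743) turn this into the exact
bi-mode coefficients (★) of MEMO-7 for every level [cite: GodsilMeagher2015, §15.2 (perfect matching scheme)].
WHAT THIS IS NOT: the binomial inversion `A_c = Σ (−1)^{a−e} C(a,e) E^{(a)}` and (★) itself are the next step; nothing on
psd rank. Supports crux stmt-PneNP-19878.
-/

set_option linter.dupNamespace false -- `Summit.PneNP.PneNP.…`: summit = sub-problem (D-0017)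

noncomputable section

namespace Summit.PneNP.PneNP.Theorems.ChebyshevTracialDesignSaturatedSubsets

open Finset Literature.Barriers.PneNP
open Summit.PneNP.PneNP.Theorems.ChebyshevTracialDesignInvolutionKeys
open Summit.PneNP.PneNP.Theorems.ChebyshevTracialDesignTightColumnSums

variable {n : ℕ}

section Invol

variable {π : Fin n → Fin n} (hinv : ∀ x, π (π x) = x) (hfix : ∀ x, π x ≠ x)
include hinv hfix

/-- **Closed subsets of `U` ↔ sets of inner keys of `U`.** The `π`-closed subsets of `U` of size `2a` are in bijection
(`V ↦ V ∩ keys`) with the `a`-subsets of the inner keys `{x ∈ U : x < π x, π x ∈ U}`. -/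
theorem card_closed_subsets_eq_choose (U : Finset (Fin n)) (a : ℕ) :
    ((powersetCard (2 * a) U).filter (fun V => ∀ x ∈ V, π x ∈ V)).card =
      ((U.filter fun x => x < π x ∧ π x ∈ U).card).choose a := by
  rw [← card_powersetCard a (U.filter fun x => x < π x ∧ π x ∈ U)]
  refine card_nbij' (fun V => V.filter (fun x => x < π x)) (fun K => K ∪ K.image π) ?_ ?_ ?_ ?_
  · intro V hV
    simp only [mem_coe, mem_filter, mem_powersetCard] at hV ⊢
    obtain ⟨⟨hVU, hVcard⟩, hcl⟩ := hV
    refine ⟨fun x hx => ?_, ?_⟩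
    · rw [mem_filter] at hx ⊢
      exact ⟨hVU hx.1, hx.2, hVU (hcl x hx.1)⟩
    · have := card_closed_eq_two_mul hinv hfix hcl
      omega
  · intro K hK
    simp only [mem_coe, mem_filter, mem_powersetCard] at hK ⊢
    obtain ⟨hKU, hKcard⟩ := hK
    have hK' : ∀ x ∈ K, x < π x := fun x hx => (mem_filter.1 (hKU hx)).2.1
    obtain ⟨hcl, -, hcard⟩ := union_image_props hinv hK'
    refine ⟨⟨fun x hx => ?_, by rw [hcard, hKcard]⟩, hcl⟩
    rcases mem_union.1 hx with h | h
    · exact (mem_filter.1 (hKU h)).1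
    · obtain ⟨y, hy, rfl⟩ := mem_image.1 h
      exact (mem_filter.1 (hKU hy)).2.2
  · intro V hV
    simp only [mem_coe, mem_filter, mem_powersetCard] at hV
    exact (closed_eq_union_image hinv hfix hV.2).symm
  · intro K hK
    simp only [mem_coe, mem_powersetCard] at hK
    exact (union_image_props hinv fun x hx => (mem_filter.1 (hK.1 hx)).2.1).2.1

/-- **Inner keys count the inner pairs**: `2 · #{x ∈ U : x < π x, π x ∈ U} = #{x ∈ U : π x ∈ U}`. -/
theorem two_mul_card_innerKeys (U : Finset (Fin n)) :
    2 * (U.filter fun x => x < π x ∧ π x ∈ U).card = (U.filter fun x => π x ∈ U).card := by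
  -- the inner part `{x ∈ U : π x ∈ U}` is closed; its keys are exactly the inner keys
  have hcl : ∀ x ∈ U.filter (fun x => π x ∈ U), π x ∈ U.filter (fun x => π x ∈ U) := by
    intro x hx
    rw [mem_filter] at hx ⊢
    exact ⟨hx.2, by rw [hinv]; exact hx.1⟩
  have h := card_closed_eq_two_mul hinv hfix hcl
  have hkeys : (U.filter (fun x => π x ∈ U)).filter (fun x => x < π x) = U.filter (fun x => x < π x ∧ π x ∈ U) := by
    ext x; simp only [mem_filter]; tauto
  rw [hkeys] at h
  exact h.symm

omit hinv hfix in
/-- `|U| = #{x ∈ U : π x ∉ U} + #{x ∈ U : π x ∈ U}` (crossing points plus inner points). -/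
theorem card_eq_unpaired_add_paired (U : Finset (Fin n)) :
    U.card = (U.filter fun x => π x ∉ U).card + (U.filter fun x => π x ∈ U).card := by
  rw [add_comm]; exact (card_filter_add_card_filter_not (fun x => π x ∈ U)).symm

end Invol

/-! ### In the route's vocabulary -/

/-- **`|U| = cc(U,M) + 2·e(U,M)`** with `e(U,M) = #inner keys = #edges of M inside U`. -/
theorem card_eq_cc_add (U : OddSet n) (M : PMatch n) :
    U.1.card = cc U M + 2 * (U.1.filter fun x => x < M.2.partner x ∧ M.2.partner x ∈ U.1).card := by
  rw [cc_eq_card_filter_partner, two_mul_card_innerKeys (partner_invol M).1 (partner_invol M).2,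
    ← card_eq_unpaired_add_paired (π := M.2.partner)]

/-- **The binomial-moment kernel**: the number of `M`-saturated `2a`-subsets of a cut `U` is `C(e(U,M), a)` where
`e(U,M) = (|U| − cc(U,M))/2` is the number of edges of `M` inside `U`. -/
theorem card_saturated_subsets (U : OddSet n) (M : PMatch n) (a : ℕ) :
    ((powersetCard (2 * a) U.1).filter (fun V => ∀ x ∈ V, M.2.partner x ∈ V)).card =
      ((U.1.card - cc U M) / 2).choose a := by
  rw [card_closed_subsets_eq_choose (partner_invol M).1 (partner_invol M).2]
  congr 1
  have := card_eq_cc_add U M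
  omega

/-- **The tight level is the top binomial moment**: for a cut of size `2l+1`, `cc(U,M) = 1` iff `e(U,M) = l`, and then the
saturated `2l`-subset is unique; otherwise there is none (`C(e, l) = 0` for `e < l`). -/
theorem card_saturated_subsets_top (U : OddSet n) (M : PMatch n) {l : ℕ} (hU : U.1.card = 2 * l + 1) :
    ((powersetCard (2 * l) U.1).filter (fun V => ∀ x ∈ V, M.2.partner x ∈ V)).card =
      if cc U M = 1 then 1 else 0 := by
  rw [card_saturated_subsets U M l, hU]
  have hcc := card_eq_cc_add U M
  rw [hU] at hcc
  -- `cc` is odd and `≥ 1`; `e = (2l+1-cc)/2 ≤ l` with equality iff `cc = 1`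
  split_ifs with h
  · rw [h]
    have : (2 * l + 1 - 1) / 2 = l := by omega
    rw [this, Nat.choose_self]
  · apply Nat.choose_eq_zero_of_lt
    omega

end Summit.PneNP.PneNP.Theorems.ChebyshevTracialDesignSaturatedSubsets
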